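import Literature.MathematicalPhysics.QuantumFieldTheory.Balaban1983to89.Beta.PoissonInterior
import Literature.MathematicalPhysics.QuantumFieldTheory.Balaban1983to89.B7Prop1Explicit
import HarnessLib

/-!
# NE7WeightedGradientBootstrap — THE WEIGHTED INTERIOR BOOTSTRAP FOR A NONLINEAR GRADIENT LETTER ON A CUBE: if at every interior point `x₀` and every admissible radius
# `R` the forward differences obey the CONDITIONAL local letter `‖∇A(x₀)‖ ≤ 2(dρ∕R + R(J₀ + θ·G))` whenever `G` bounds `∇A` on the cube of radius `R+1` about `x₀`, and
# `4θR₀ ≤ 1`, then `dist(x, ∂)·‖∇A(x)‖ ≤ 18dρ + 2R₀²J₀` on the whole cube of radius `R₀` — hence `‖∇A‖ ≤ 36dρ∕R₀ + 4R₀J₀` on the half cube.  NO boundary regularity,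
# NO logarithm: the weight makes the absorption coefficient `θ·dist ≤ θR₀` position-independent (file G2 of gen 112's BOX ROUTE to [Balaban1985Variational] Thm 1 (9)∕(10))

Cell `pub-balaban`, rung (B)+1 sub-cell t4, lineage `b2b-balaban-t4-ne7-p1` (CRUX PROVER NE7 #1 = OWNER of BINDER row NE7), generation 112.  Memo
`t4/b2b-balaban-t4-ne7-p1-g112/ROAD-G112.md` §5.  Pure lattice∕real analysis over pv23's `Beta/PoissonInterior` cubes (`cube`, `supNorm`); the conditional local letter is the
shape delivered by (156) `NE7LatticeHodgeGradient.norm_fdiff_le_of_curl_div` once the curl-divergence and the divergence-gradient of a Landau representative `W = e^{A}` are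
converted to the covariant current plus `θ·G` (G1 `NE7LocalLandauLetters`; θ = 4d(e^{4ρ}−1) + 2d(e^{ρ}−1) = O(ρ)`).
WHY (row NE7).  Gen 93's one-scale lattice Uhlenbeck lemma (`NE7CubeLandauChart.cube_landau_chart`) supplies, on a cube of side `≍ ℓM` about any point, a free-boundary Landau
gauge with the printed sup currency `ρ ≲ ℓ·r∕M` — but no gradient letter; the global (torus) absorption of (157)∕(158b) is unavailable on a box, and interior estimates with a
FIXED collar do not close (the crude start `‖∇A‖ ≤ 2ρ` is a factor `M` off and each step gains only `O(ℓ²r)`).  The classical remedy is the weighted seminorm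
`sup_x dist(x,∂)·‖∇A(x)‖`: at its maximiser `x*` (weight `D*`) the cube of radius `D*∕2` consists of points of weight `≥ D*∕2`, so `∇A ≤ 2Φ∕D*` there, and the local letter
with `R ≍ D*∕2` returns `Φ ≤ 8dρ + R₀²J₀ + 2θR₀·Φ` — absorbed once `4θR₀ ≤ 1`, i.e. `ρ·ℓM = O(ℓ²r) ≪ 1`, the small-curvature regime of the cube, uniformly in `M`.
WHAT ([folklore]; 0 def, 0 sorry; every `d ≥ 1`, any normed group `E`).  **`weighted_gradient_bootstrap`** (the weighted letter on the whole cube) and **`gradient_halfCube_of_bootstrap`**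
(`‖A(x+e_τ)_κ − A(x)_κ‖ ≤ 36dρ∕R₀ + 4R₀J₀` for `|x − z|_∞ ≤ R₀∕2`, `R₀ ≥ 2`).
HONEST FRAMING (page 1): an abstract bootstrap lemma; the conditional local letter, `ρ`, `J₀`, `θ` are HYPOTHESES; nothing of Bałaban's asserted; nothing about minimisers here;
NOT NE3∕NE7 as spine nodes; spine 0∕9; finite T⁴ rung (B)+1 — NOT infinite volume, NOT mass gap, NOT BetaPertH, NOT Clay (continuum YM on T⁴ ⇐ BetaPertH ∧ nine spine estimates).
-/

set_option autoImplicit false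

open scoped BigOperators
open Finset

namespace Summit.QuantumFields.BalabanUV.T4Continuum.NE7WeightedGradientBootstrap

open Literature.MathematicalPhysics.QuantumFieldTheory.Balaban1983to89
open B7Prop1Explicit (Site e)
open Beta.PoissonInterior (cube mem_cube mem_cube_iff_supNorm supNorm supNorm_add_le supNorm_neg supNorm_single_one supNorm_zero)

noncomputable section

variable {d : ℕ} {E : Type*} [NormedAddCommGroup E]

/-- `|e_τ|_∞ ≤ 1` in the `B7Prop1Explicit.e` spelling. [folklore] -/
theorem supNorm_e_le (τ : Fin d) : supNorm (e τ : Site d) ≤ 1 := supNorm_single_one τ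

/-- Triangle inequality for `supNorm` of differences: `|a − c|_∞ ≤ |a − b|_∞ + |b − c|_∞`. [folklore] -/
theorem supNorm_sub_le_of (a b c : Site d) : supNorm (a - c) ≤ supNorm (a - b) + supNorm (b - c) := by
  simpa using supNorm_add_le (a - b) (b - c)

/-- **THE WEIGHTED INTERIOR BOOTSTRAP.**  Let `A : ℤᵈ → (Fin d → E)` (`d ≥ 1`), a centre `z`, a radius `R₀`, and reals `ρ, J₀ ≥ 0`, `θ ≥ 0` with `4θR₀ ≤ 1`.  Assume
(i) `‖A(x)_κ‖ ≤ ρ` for `|x − z|_∞ ≤ R₀ + 1`; (ii) the CONDITIONAL LOCAL LETTER: for every `x₀` with `|x₀ − z|_∞ ≤ R₀`, every `R ≥ 1` with `R + 2 + |x₀ − z|_∞ ≤ R₀` and every `G`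
bounding `‖A(y+e_τ)_κ − A(y)_κ‖` for `|y − x₀|_∞ ≤ R + 1`: `‖A(x₀+e_τ)_κ − A(x₀)_κ‖ ≤ 2(dρ∕R + R(J₀ + θG))`.  THEN for every `x` with `|x − z|_∞ ≤ R₀` and all `κ, τ`:
`(R₀ − |x − z|_∞)·‖A(x+e_τ)_κ − A(x)_κ‖ ≤ 18dρ + 2R₀²J₀`. [folklore] -/
theorem weighted_gradient_bootstrap (hd : 1 ≤ d) (A : Site d → Fin d → E) (z : Site d) (R₀ : ℕ) {ρ J₀ θ : ℝ}
    (hρ0 : 0 ≤ ρ) (hJ0 : 0 ≤ J₀) (hθ0 : 0 ≤ θ) (hθ : 4 * θ * R₀ ≤ 1)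
    (hρ : ∀ x : Site d, supNorm (x - z) ≤ R₀ + 1 → ∀ κ : Fin d, ‖A x κ‖ ≤ ρ)
    (hloc : ∀ x₀ : Site d, supNorm (x₀ - z) ≤ R₀ → ∀ R : ℕ, 1 ≤ R → R + 2 + supNorm (x₀ - z) ≤ R₀ →
      ∀ G : ℝ, (∀ y : Site d, supNorm (y - x₀) ≤ R + 1 → ∀ κ τ : Fin d, ‖A (y + e τ) κ - A y κ‖ ≤ G) →
      ∀ κ τ : Fin d, ‖A (x₀ + e τ) κ - A x₀ κ‖ ≤ 2 * ((d : ℝ) * ρ / R + R * (J₀ + θ * G)))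
    (x : Site d) (hx : supNorm (x - z) ≤ R₀) (κ τ : Fin d) :
    (((R₀ - supNorm (x - z) : ℕ) : ℝ)) * ‖A (x + e τ) κ - A x κ‖ ≤ 18 * d * ρ + 2 * (R₀ : ℝ) ^ 2 * J₀ := by
  haveI : Nonempty (Fin d) := ⟨⟨0, hd⟩⟩
  have hd1 : (1 : ℝ) ≤ d := by exact_mod_cast hd
  -- the finite family of weighted increments and its maximiser
  set S : Finset (Site d × Fin d × Fin d) := (cube z R₀) ×ˢ (Finset.univ ×ˢ Finset.univ) with hSdef
  set f : Site d × Fin d × Fin d → ℝ := fun p => (((R₀ - supNorm (p.1 - z) : ℕ) : ℝ)) * ‖A (p.1 + e p.2.2) p.2.1 - A p.1 p.2.1‖ with hfdef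
  have hxS : (x, κ, τ) ∈ S := by
    simp only [hSdef, Finset.mem_product, Finset.mem_univ, and_true, mem_cube_iff_supNorm]; exact hx
  have hSne : S.Nonempty := ⟨_, hxS⟩
  obtain ⟨p, hpS, hpmax⟩ := Finset.exists_max_image S f hSne
  obtain ⟨xs, κs, τs⟩ := p
  set Φ : ℝ := f (xs, κs, τs) with hΦdef
  have hxs : supNorm (xs - z) ≤ R₀ := by
    simp only [hSdef, Finset.mem_product, Finset.mem_univ, and_true, mem_cube_iff_supNorm] at hpS; exact hpS
  -- every weighted increment on the cube is `≤ Φ`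
  have hle : ∀ y : Site d, supNorm (y - z) ≤ R₀ → ∀ κ' τ' : Fin d,
      (((R₀ - supNorm (y - z) : ℕ) : ℝ)) * ‖A (y + e τ') κ' - A y κ'‖ ≤ Φ := by
    intro y hy κ' τ'
    have hyS : (y, κ', τ') ∈ S := by
      simp only [hSdef, Finset.mem_product, Finset.mem_univ, and_true, mem_cube_iff_supNorm]; exact hy
    exact hpmax (y, κ', τ') hyS
  -- it suffices to bound `Φ`
  suffices hΦ : Φ ≤ 18 * d * ρ + 2 * (R₀ : ℝ) ^ 2 * J₀ from (hle x hx κ τ).trans hΦ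
  -- the trivial bound `‖∇A‖ ≤ 2ρ` on the cube
  have htriv : ‖A (xs + e τs) κs - A xs κs‖ ≤ 2 * ρ := by
    have h1 : ‖A xs κs‖ ≤ ρ := hρ xs (by omega) κs
    have h2 : ‖A (xs + e τs) κs‖ ≤ ρ := by
      refine hρ (xs + e τs) ?_ κs
      have := supNorm_add_le (xs - z) (e τs)
      rw [show xs - z + e τs = xs + e τs - z by abel] at this
      have := supNorm_e_le (d := d) τs
      omega
    calc _ ≤ ‖A (xs + e τs) κs‖ + ‖A xs κs‖ := norm_sub_le _ _
      _ ≤ ρ + ρ := add_le_add h2 h1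
      _ = 2 * ρ := by ring
  set Ds : ℕ := R₀ - supNorm (xs - z) with hDsdef
  have hΦeq : Φ = (Ds : ℝ) * ‖A (xs + e τs) κs - A xs κs‖ := rfl
  have hR₀J : 0 ≤ 2 * (R₀ : ℝ) ^ 2 * J₀ := by positivity
  by_cases hsmall : Ds ≤ 9
  · -- small weight: `Φ ≤ 9·2ρ ≤ 18dρ`
    have hDs9 : (Ds : ℝ) ≤ 9 := by exact_mod_cast hsmall
    calc Φ = (Ds : ℝ) * ‖A (xs + e τs) κs - A xs κs‖ := hΦeq
      _ ≤ 9 * (2 * ρ) := mul_le_mul hDs9 htriv (norm_nonneg _) (by norm_num)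
      _ ≤ 18 * d * ρ + 2 * (R₀ : ℝ) ^ 2 * J₀ := by nlinarith
  · -- large weight: the local letter at `xs` with radius `R = (Ds − 2)/2` and `G = 2Φ/Ds`
    rw [not_le] at hsmall
    set R : ℕ := (Ds - 2) / 2 with hRdef
    have hR1 : 1 ≤ R := by omega
    have hR2 : 2 * R + 2 ≤ Ds := by omega
    have hR3 : Ds ≤ 4 * R := by omega
    have hRfit : R + 2 + supNorm (xs - z) ≤ R₀ := by omega
    have hDs0 : (0 : ℝ) < Ds := by exact_mod_cast (by omega : 0 < Ds)
    have hΦ0 : 0 ≤ Φ := by rw [hΦeq]; positivity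
    -- the gradient bound on the cube of radius `R + 1` about `xs`
    have hG : ∀ y : Site d, supNorm (y - xs) ≤ R + 1 → ∀ κ' τ' : Fin d, ‖A (y + e τ') κ' - A y κ'‖ ≤ 2 * Φ / Ds := by
      intro y hy κ' τ'
      have hyz : supNorm (y - z) ≤ supNorm (y - xs) + supNorm (xs - z) := supNorm_sub_le_of y xs z
      have hyR₀ : supNorm (y - z) ≤ R₀ := by omega
      have hwy : Ds ≤ 2 * (R₀ - supNorm (y - z)) := by omega
      have hwy' : (Ds : ℝ) ≤ 2 * (((R₀ - supNorm (y - z) : ℕ) : ℝ)) := by exact_mod_cast hwy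
      have hw0 : (0 : ℝ) < (((R₀ - supNorm (y - z) : ℕ) : ℝ)) := by
        have : 0 < R₀ - supNorm (y - z) := by omega
        exact_mod_cast this
      have h := hle y hyR₀ κ' τ'
      rw [le_div_iff₀ hDs0]
      calc ‖A (y + e τ') κ' - A y κ'‖ * Ds ≤ ‖A (y + e τ') κ' - A y κ'‖ * (2 * (((R₀ - supNorm (y - z) : ℕ) : ℝ))) :=
            mul_le_mul_of_nonneg_left hwy' (norm_nonneg _)
        _ = 2 * ((((R₀ - supNorm (y - z) : ℕ) : ℝ)) * ‖A (y + e τ') κ' - A y κ'‖) := by ring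
        _ ≤ 2 * Φ := by linarith
    have hstep := hloc xs hxs R hR1 hRfit (2 * Φ / Ds) hG κs τs
    -- multiply by the weight and absorb
    have hR0 : (0 : ℝ) < R := by exact_mod_cast (by omega : 0 < R)
    have hRr : (1 : ℝ) ≤ R := by exact_mod_cast hR1
    have hR3r : (Ds : ℝ) ≤ 4 * R := by exact_mod_cast hR3
    have hR2r : 2 * (R : ℝ) + 2 ≤ Ds := by exact_mod_cast hR2
    have hDsR₀ : (Ds : ℝ) ≤ R₀ := by exact_mod_cast (by omega : Ds ≤ R₀)
    have hRR₀ : (R : ℝ) ≤ R₀ := by linarith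
    have key : Φ ≤ 8 * d * ρ + (R₀ : ℝ) ^ 2 * J₀ + 2 * θ * R₀ * Φ := by
      have h1 : Φ ≤ (Ds : ℝ) * (2 * ((d : ℝ) * ρ / R + R * (J₀ + θ * (2 * Φ / Ds)))) := by
        rw [hΦeq]; exact mul_le_mul_of_nonneg_left hstep hDs0.le
      have e1 : (Ds : ℝ) * (2 * ((d : ℝ) * ρ / R + R * (J₀ + θ * (2 * Φ / Ds))))
          = 2 * (d * ρ) * ((Ds : ℝ) / R) + 2 * ((Ds : ℝ) * R) * J₀ + 4 * R * θ * Φ := by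
        field_simp
        ring
      rw [e1] at h1
      have t1 : (Ds : ℝ) / R ≤ 4 := by rw [div_le_iff₀ hR0]; linarith
      have t2 : (Ds : ℝ) * R ≤ (R₀ : ℝ) ^ 2 / 2 := by nlinarith
      have t3 : 4 * (R : ℝ) * θ * Φ ≤ 2 * θ * R₀ * Φ := by
        have : 4 * (R : ℝ) * θ ≤ 2 * θ * R₀ := by nlinarith
        exact mul_le_mul_of_nonneg_right this hΦ0
      have hdρ : 0 ≤ (d : ℝ) * ρ := by positivity
      nlinarith [mul_le_mul_of_nonneg_left t1 (by positivity : (0:ℝ) ≤ 2 * (d * ρ)),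
        mul_le_mul_of_nonneg_right t2 (by positivity : (0:ℝ) ≤ 2 * J₀)]
    have habs : 2 * θ * R₀ * Φ ≤ Φ / 2 := by
      have : 2 * θ * (R₀ : ℝ) ≤ 1 / 2 := by linarith
      have := mul_le_mul_of_nonneg_right this hΦ0
      linarith
    nlinarith

/-- **THE GRADIENT LETTER ON THE HALF CUBE.**  Under the hypotheses of `weighted_gradient_bootstrap` and `R₀ ≥ 2`: for every `x` with `2|x − z|_∞ ≤ R₀` and all `κ, τ`,
`‖A(x+e_τ)_κ − A(x)_κ‖ ≤ 36dρ∕R₀ + 4R₀J₀`. [folklore] -/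
theorem gradient_halfCube_of_bootstrap (hd : 1 ≤ d) (A : Site d → Fin d → E) (z : Site d) {R₀ : ℕ} (hR₀ : 2 ≤ R₀) {ρ J₀ θ : ℝ}
    (hρ0 : 0 ≤ ρ) (hJ0 : 0 ≤ J₀) (hθ0 : 0 ≤ θ) (hθ : 4 * θ * R₀ ≤ 1)
    (hρ : ∀ x : Site d, supNorm (x - z) ≤ R₀ + 1 → ∀ κ : Fin d, ‖A x κ‖ ≤ ρ)
    (hloc : ∀ x₀ : Site d, supNorm (x₀ - z) ≤ R₀ → ∀ R : ℕ, 1 ≤ R → R + 2 + supNorm (x₀ - z) ≤ R₀ →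
      ∀ G : ℝ, (∀ y : Site d, supNorm (y - x₀) ≤ R + 1 → ∀ κ τ : Fin d, ‖A (y + e τ) κ - A y κ‖ ≤ G) →
      ∀ κ τ : Fin d, ‖A (x₀ + e τ) κ - A x₀ κ‖ ≤ 2 * ((d : ℝ) * ρ / R + R * (J₀ + θ * G)))
    (x : Site d) (hx : 2 * supNorm (x - z) ≤ R₀) (κ τ : Fin d) :
    ‖A (x + e τ) κ - A x κ‖ ≤ 36 * d * ρ / R₀ + 4 * R₀ * J₀ := by
  have hxR₀ : supNorm (x - z) ≤ R₀ := by omega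
  have h := weighted_gradient_bootstrap hd A z R₀ hρ0 hJ0 hθ0 hθ hρ hloc x hxR₀ κ τ
  have hw : (R₀ : ℝ) ≤ 2 * (((R₀ - supNorm (x - z) : ℕ) : ℝ)) := by
    have : R₀ ≤ 2 * (R₀ - supNorm (x - z)) := by omega
    exact_mod_cast this
  have hR₀0 : (0 : ℝ) < R₀ := by exact_mod_cast (by omega : 0 < R₀)
  have hw0 : (0 : ℝ) < (((R₀ - supNorm (x - z) : ℕ) : ℝ)) := by linarith
  rw [← sub_nonneg]
  have e1 : 36 * (d : ℝ) * ρ / R₀ + 4 * R₀ * J₀ - ‖A (x + e τ) κ - A x κ‖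
      = (2 * (18 * d * ρ + 2 * (R₀ : ℝ) ^ 2 * J₀) - R₀ * ‖A (x + e τ) κ - A x κ‖) / R₀ := by
    field_simp
    ring
  rw [e1]
  apply div_nonneg _ hR₀0.le
  have : (R₀ : ℝ) * ‖A (x + e τ) κ - A x κ‖ ≤ 2 * ((((R₀ - supNorm (x - z) : ℕ) : ℝ)) * ‖A (x + e τ) κ - A x κ‖) := by
    have := mul_le_mul_of_nonneg_right hw (norm_nonneg (A (x + e τ) κ - A x κ))
    linarith
  linarith

end

end Summit.QuantumFields.BalabanUV.T4Continuum.NE7WeightedGradientBootstrap
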